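import Literature.Topology.FourManifolds.TautFoliationsNovikovReduction
import Literature.Topology.FourManifolds.TautFoliationsVanishingCycle
import HarnessLib

/-!
# Novikov's theorem through vanishing cycles: the decomposition of
# `Foliation.fundamentalGroup_map_injective_of_isTaut`

Topic `Literature/Topology/FourManifolds`. Fact decomposition (librarian, mode `fact-decompose`,
2026-08-16) of the XL named fact
`Literature.Topology.FourManifolds.Foliation.fundamentalGroup_map_injective_of_isTaut`
(`TautFoliationsNovikov.lean`; Novikov (1965), Gabai (1983) Thm. 2.8 (4), Schultens (2014)
Thm. 7.5.12 (i): compact leaves of transversely oriented taut `C⁰` foliations of closed oriented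
3-manifolds are `π₁`-injective; `C⁰`: Solodov (1984), Bowden (2016) Thm. 2.7).

The printed proof (Novikov 1965 §§5–6; Camacho–Lins Neto, *Geometric Theory of Foliations*,
Ch. VII) has three parts:

1. a leaf loop that is essential in its leaf but inessential in `M` yields, after putting the
   null-homotopy in general position with respect to the foliation and a Poincaré–Bendixson
   analysis of the induced singular foliation of the disc, a **vanishing cycle** (CLN Ch. VII §1
   Definition, §2) — CHILD 1 `exists_vanishingCycle_of_not_injective`, over the tree's notion
   `Foliation.VanishingCycle` (`TautFoliationsVanishingCycle.lean`, the weak topological form);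
2. a vanishing cycle lies on the boundary leaf of a **Reeb component** (CLN Ch. VII §§3–4; Novikov
   §6), in particular some leaf is the frontier of a closed region that is the closure of its
   interior — CHILD 2 `exists_region_of_vanishingCycle`;
3. a taut foliation has no such leaf (Goodman; Schultens Lemma 7.5.14) — PROVED in the tree
   (`Foliation.frontier_ne_leaf_of_isTaut`, `TautFoliationsDeadEnds.lean`), packaged as the
   reduction `fundamentalGroup_map_injective_of_isTaut_of_core` (`TautFoliationsNovikovReduction.lean`).

ASSEMBLY `fundamentalGroup_map_injective_of_isTaut_holds_of` (PROVED): children 1 and 2 give the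
hypothesis `hcore` of that reduction. Neither child restates the parent. The disc analysis of part
1 is the object of the parent's seat (`TautFoliations*.lean`, `Topology/PlanarFoliations/*.lean`,
2026-08-15/16: cone position, fences, tame height functions, level circles, collars, prong stars).

## References

* S. P. Novikov, *The topology of foliations*, Trudy Moskov. Mat. Obšč. 14 (1965) 248–278, §§5–6.
  [Novikov1965]
* C. Camacho, A. Lins Neto, *Geometric Theory of Foliations*, Birkhäuser (1985), Ch. VII §§1–4.
  [CamachoLinsNeto1985]
* D. Gabai, J. Differential Geom. 18 (1983), Thm. 2.8 (4). [Gabai1983]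
* V. V. Solodov, Math. USSR-Sb. 47 (1984) 329–343. [Solodov1984]
* J. Bowden, Geom. Funct. Anal. 26 (2016), Thm. 2.7. [Bowden2016]
-/

open scoped Manifold ContDiff Topology
open Function Set

noncomputable section

universe u

namespace Literature.Topology.FourManifolds

/-- Local notation: `𝔼 n` is the model Euclidean space `EuclideanSpace ℝ (Fin n)`. -/
local notation "𝔼 " n:arg => EuclideanSpace ℝ (Fin n)

namespace Foliation

/-- NAMED FACT (split child 1 of `fundamentalGroup_map_injective_of_isTaut`) — **Novikov:
existence of a vanishing cycle** (Novikov (1965) §5; Camacho–Lins Neto, Ch. VII §2: if some leaf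
loop is not null-homotopic in its leaf but null-homotopic in `M`, the foliation has a vanishing
cycle; `C⁰` foliations: Solodov (1984)). For a closed (compact, boundaryless) connected oriented
3-manifold `M`, a transversely oriented codimension-one `C⁰` foliation `F` of `M` by surfaces and a
compact leaf `F.leaf x` whose inclusion is not `π₁`-injective at some base point, `F` admits a
vanishing cycle in the weak topological sense of `Foliation.VanishingCycle`
(`TautFoliationsVanishingCycle.lean`: a family of leafwise loops `f_t`, `t ∈ [0, ε)`, `f_0`
essential and `f_t` (`t > 0`) inessential in their leaves, the curves `t ↦ f_t(θ)` topologically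
transverse to `F`). [cite: CamachoLinsNeto1985, Ch. VII §2] [cite: Novikov1965, §5]
[cite: Solodov1984, Thm. (Novikov for C⁰ foliations)] -/
def exists_vanishingCycle_of_not_injective : Prop :=
  ∀ {EM HM : Type} [NormedAddCommGroup EM] [NormedSpace ℝ EM]
    [FiniteDimensional ℝ EM] [TopologicalSpace HM] (IM : ModelWithCorners ℝ EM HM)
    [IM.Boundaryless] (_hdim : Module.finrank ℝ EM = 3)
    (M : Type u) [TopologicalSpace M] [T2Space M] [SecondCountableTopology M] [CompactSpace M]
    [ConnectedSpace M] [ChartedSpace HM M] [IsManifold IM ∞ M] (_hM : IsOrientable IM M)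
    (F : Foliation (𝔼 2) M) (_ho : F.IsTransverselyOriented)
    (x : M) (_hx : IsCompact (F.leaf x)) (p : F.leaf x),
    ¬ Injective (FundamentalGroup.map
        (⟨Subtype.val, continuous_subtype_val⟩ : C(F.leaf x, M)) p) →
      Nonempty F.VanishingCycle

/-- NAMED FACT (split child 2 of `fundamentalGroup_map_injective_of_isTaut`) — **Novikov: a
vanishing cycle produces a Reeb component** (Novikov (1965) §6; Camacho–Lins Neto, Ch. VII §§3–4,
Thm.: a foliation with a vanishing cycle has a Reeb component, whose boundary torus is a compact
leaf bounding the solid torus it fills; `C⁰`: Solodov (1984)), in the weak form consumed by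
`fundamentalGroup_map_injective_of_isTaut_of_core`: for `M` and `F` as above, if `F` has a
vanishing cycle then some leaf `F.leaf x'` is the frontier of a closed region `R ⊆ M` with
`closure (interior R) = R`. [cite: CamachoLinsNeto1985, Ch. VII §§3–4] [cite: Novikov1965, §6]
[cite: Solodov1984, Thm. (Novikov for C⁰ foliations)] -/
def exists_region_of_vanishingCycle : Prop :=
  ∀ {EM HM : Type} [NormedAddCommGroup EM] [NormedSpace ℝ EM]
    [FiniteDimensional ℝ EM] [TopologicalSpace HM] (IM : ModelWithCorners ℝ EM HM)
    [IM.Boundaryless] (_hdim : Module.finrank ℝ EM = 3)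
    (M : Type u) [TopologicalSpace M] [T2Space M] [SecondCountableTopology M] [CompactSpace M]
    [ConnectedSpace M] [ChartedSpace HM M] [IsManifold IM ∞ M] (_hM : IsOrientable IM M)
    (F : Foliation (𝔼 2) M) (_ho : F.IsTransverselyOriented),
    F.VanishingCycle → ∃ (R : Set M) (x' : M), closure (interior R) = R ∧ frontier R = F.leaf x'

/-- ASSEMBLY of the split of `fundamentalGroup_map_injective_of_isTaut` (PROVED): children 1 and 2
supply the core hypothesis of `fundamentalGroup_map_injective_of_isTaut_of_core`
(`TautFoliationsNovikovReduction.lean`), whose remaining step — a taut foliation has no leaf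
bounding a regular closed region — is proved in `TautFoliationsDeadEnds.lean`.
[cite: Gabai1983, Thm. 2.8 (4)] -/
theorem fundamentalGroup_map_injective_of_isTaut_holds_of
    (h₁ : exists_vanishingCycle_of_not_injective.{u}) (h₂ : exists_region_of_vanishingCycle.{u}) :
    fundamentalGroup_map_injective_of_isTaut.{u} :=
  fundamentalGroup_map_injective_of_isTaut_of_core
    fun IM _ hdim M _ _ _ _ _ _ _ hM F ho x hx p hinj =>
      h₂ IM hdim M hM F ho (h₁ IM hdim M hM F ho x hx p hinj).some

end Foliation

end Literature.Topology.FourManifolds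

end
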